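import Summits.QuantumFields.BalabanUV.Beta.AxialDressingRootedLinear

/-!
# The ROOTED axial dressing `Πᵀ_ρ` — part 6: the DRESSED-KERNEL IDENTITY
# `TstepOf Lc j (dressAt hr J) = hessKer G (vertexOfK G Lc J.S) J.W`, `G = Π_ρ · KInvStep Lc j · Πᵀ_ρ`

HONEST FRAMING (cell charter, verbatim): «discharging BetaPertH makes Balaban's UV stability UNCONDITIONAL — a real
constructive-QFT result; it is NOT the continuum limit and NOT the Clay problem.»  DERIVED cell leaf (pub-balaban β sub-cell,
lane an2 gen 12, item (ii-0) of NOTE X-an2-41 §4, file 3 of 3); no statement of Bałaban's papers is typed here, no `[cite:]` tag,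
no `Prop` fact; it instantiates no binder of the β-function wall by itself.  NOT `BetaPertH`; NOT continuum; NOT Clay.

## What is here (over parts 4–5: `piK`, `dressKAt = piK∘K∘piKᵀ`, `coDressKAt K = piKᵀ∘K∘piK`, `vertexOfK_dressKAt`)

* §6 the windowed adjoint `coProjW ρ N` on weight families (`= colH` of the co-dressed kernel, `colH_coDressKAt_eq`), THE WINDOWED
  ADJUNCTION `sum_tsum_mul_coProjAt` (summable weights against `Πᵀ_ρ` of a bounded family; finite sums out of the series, one lattice
  shift per window offset), the bond slot `vertexOfK_coProjAtK`, and **`vertexOfK_dressAt_S`**: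
  `vertexOfK K N (dressAt hr J).S μ y = dressKAt ρ N (vertexOfK (coDressKAt ρ N K) N J.S μ y)`.
* §7 **`hessKer_dressAt`**: for every decaying `K`, every jet datum `J` and every in-block root,
  `hessKer K (vertexOfK K N (dressAt hr J).S) (dressAt hr J).W = hessKer G (vertexOfK G N J.S) J.W`, `G := coDressKAt (toSite r) N K`
  — tame trace cyclicity and associativity (an5's `TameKernelCalculus.tr_comp_comm_loc` / `comp_assoc_tame` BY NAME);
  **`TstepOf_dressAt`**, **`TbalOf_dressAt`** (d = 3), `decays_coDressKAt_KInvStep`, `shiftK_coDressKAt_KInvStep`: the wall family's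
  one-step kernels in the shape `hessKer K′ (vertexOfK K′ N J.S) J.W` of `ChartConjugationEnd.axisReflectionCovariant_flipK_hessKer_conj`,
  with `K′ := G_j` (decaying, block-translation invariant) and the UNDRESSED jets `J`.

Nothing here asserts an inverse identity for `G` (X-an2-41: `G` is a RELATIVE inverse of the undressed bordered Hessian; the four
relative rules are item (ii-1), a separate leaf); nothing of the wall is discharged.
All declarations `[folklore]` (finite sums, absolutely convergent lattice sums); axioms standard.
Provenance: b2b-balaban β sub-cell, unit beta-an2 gen 12, 2026-08-19 (v1); over parts 4–5, an5's `TameKernelCalculus`,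
`AxialDressing.summable_col_of_decays` and `KKTFluctuationEnergy.tsum_shift_sub` BY NAME; no existing file touched.
-/

open Finset
open scoped BigOperators
open Literature.MathematicalPhysics.QuantumFieldTheory
open Literature.MathematicalPhysics.QuantumFieldTheory.Balaban1983to89
open Literature.MathematicalPhysics.QuantumFieldTheory.Balaban1983to89.Beta
open B12Sec2to5 (l1 l1_nonneg)
open ExpKernelCalculus (MKer Decays BiLoc comp tr bubble tadpole hessKer VertexFamily VertexFamily₂ shiftK l1_sub_symm)
open AffineAveraging (Form0 Form1 box toSite)
open AveragingContoursRooted (ctrOff ctrOff_mem_box)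
open OneStepResolventKernel (Fib wsum LocStencil JetData)
open OneStepKernelFamily (KInvStep decays_KInvStep shiftK_KInvStep colH vertexOfK vertexFamily_vertexOfK' TstepOf TbalOf)
open Summit.QuantumFields.BalabanUV.Beta.TameKernelCalculus

namespace Summit.QuantumFields.BalabanUV.Beta.AxialDressingRooted

noncomputable section

variable {d : ℕ}

/-! ## §6 The windowed adjunction and the bond slot -/

section Adjunction

/-- [folklore] **THE WINDOWED `Π_ρ` ON WEIGHT FAMILIES**: `coProjW ρ N A κ′ u′ := Σ_{v ∈ cube} Σ_κ pm ρ N κ′ u′ κ (u′ − v) · A κ (u′ − v)`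
(the adjoint of the window operator `coProjAt ρ N`; for `A := colH K N μ y` it is the `ℋ`-column of the co-dressed kernel,
part 4 `colH_coDressKAt`). -/
def coProjW (ρ : Fin (d + 1) → ℤ) (N : ℕ) (A : Form1 (d + 1) ℝ) : Form1 (d + 1) ℝ :=
  fun κ' u' => ∑ v ∈ cube (d + 1) N, ∑ κ : Fin (d + 1), (pm ρ N κ' u' κ (u' - v) : ℝ) * A κ (u' - v)

/-- [folklore] `coProjW` unfolds. -/
theorem coProjW_apply (ρ : Fin (d + 1) → ℤ) (N : ℕ) (A : Form1 (d + 1) ℝ) (κ' : Fin (d + 1)) (u' : Fin (d + 1) → ℤ) :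
    coProjW ρ N A κ' u' = ∑ v ∈ cube (d + 1) N, ∑ κ : Fin (d + 1), (pm ρ N κ' u' κ (u' - v) : ℝ) * A κ (u' - v) := rfl

/-- [folklore] The `ℋ`-column of the co-dressed kernel is `coProjW` of the `ℋ`-column (part 4 `colH_coDressKAt`). -/
theorem colH_coDressKAt_eq (ρ : Fin (d + 1) → ℤ) (N : ℕ) (K : MKer (d + 1) (Fib d)) (μ : Fin (d + 1))
    (y : Fin (d + 1) → ℤ) : colH (coDressKAt ρ N K) N μ y = coProjW ρ N (colH K N μ y) :=
  funext fun κ' => funext fun u' => colH_coDressKAt ρ N K μ y κ' u'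

/-- [folklore] **THE WINDOWED ADJUNCTION** `Σ_κ Σ'_u A κ u · (Πᵀ_ρ g) κ u = Σ_κ′ Σ'_u′ (coProjW ρ N A) κ′ u′ · g κ′ u′` for
summable weights `A` and bounded `g` (in-block root; finite sums out of the series, one lattice shift per window offset). -/
theorem sum_tsum_mul_coProjAt {N : ℕ} (hN : 1 ≤ N) {r : Fin (d + 1) → ℕ} (hr : r ∈ box (d + 1) N)
    {A g : Form1 (d + 1) ℝ} (hA : ∀ κ, Summable (A κ)) {M : ℝ} (hg : ∀ κ u, |g κ u| ≤ M) :
    ∑ κ : Fin (d + 1), ∑' u, A κ u * coProjAt (toSite r) N g κ u =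
      ∑ κ' : Fin (d + 1), ∑' u', coProjW (toSite r) N A κ' u' * g κ' u' := by
  set B : ℝ := (1 + 2 * (((d + 1 : ℕ) : ℝ) * N)) * |M| with hB
  -- termwise bound: `|A κ u · pm · g| ≤ |A κ u| · B`
  have hterm : ∀ (κ κ' : Fin (d + 1)) (u w p : Fin (d + 1) → ℤ),
      |A κ u * ((pm (toSite r) N κ' w κ p : ℝ) * g κ' w)| ≤ |A κ u| * B := by
    intro κ κ' u w p
    rw [abs_mul, abs_mul]
    refine mul_le_mul_of_nonneg_left ?_ (abs_nonneg _)
    exact mul_le_mul (abs_pm_le_real hN hr κ' w κ p) ((hg κ' w).trans (le_abs_self M)) (abs_nonneg _)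
      (by positivity)
  -- summability of the pieces, before and after the shift
  have hs1 : ∀ (κ κ' : Fin (d + 1)) (v : Fin (d + 1) → ℤ),
      Summable fun u => A κ u * ((pm (toSite r) N κ' (u + v) κ u : ℝ) * g κ' (u + v)) := fun κ κ' v =>
    Summable.of_norm_bounded ((hA κ).abs.mul_right B) fun u => by
      rw [Real.norm_eq_abs]; exact hterm κ κ' u (u + v) u
  have hs2 : ∀ (κ κ' : Fin (d + 1)) (v : Fin (d + 1) → ℤ),
      Summable fun u' => A κ (u' - v) * ((pm (toSite r) N κ' u' κ (u' - v) : ℝ) * g κ' u') := fun κ κ' v =>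
    Summable.of_norm_bounded (((Equiv.subRight v).summable_iff.2 (hA κ)).abs.mul_right B) fun u' => by
      rw [Real.norm_eq_abs]; exact hterm κ κ' (u' - v) u' (u' - v)
  -- left side: finite sums out, then shift `u ↦ u′ − v`
  have hL : ∀ κ : Fin (d + 1), ∑' u, A κ u * coProjAt (toSite r) N g κ u =
      ∑ v ∈ cube (d + 1) N, ∑ κ' : Fin (d + 1), ∑' u', A κ (u' - v) * ((pm (toSite r) N κ' u' κ (u' - v) : ℝ) * g κ' u') := by
    intro κ
    have e1 : (fun u => A κ u * coProjAt (toSite r) N g κ u) = fun u => ∑ v ∈ cube (d + 1) N, ∑ κ' : Fin (d + 1),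
        A κ u * ((pm (toSite r) N κ' (u + v) κ u : ℝ) * g κ' (u + v)) := by
      funext u
      rw [coProjAt_apply, Finset.mul_sum]
      exact Finset.sum_congr rfl fun v _ => by rw [Finset.mul_sum]
    rw [e1, Summable.tsum_finsetSum (fun v _ => summable_sum fun κ' _ => hs1 κ κ' v)]
    refine Finset.sum_congr rfl fun v _ => ?_
    rw [Summable.tsum_finsetSum (fun κ' _ => hs1 κ κ' v)]
    refine Finset.sum_congr rfl fun κ' _ => ?_
    rw [← KKTFluctuationEnergy.tsum_shift_sub
      (fun u => A κ u * ((pm (toSite r) N κ' (u + v) κ u : ℝ) * g κ' (u + v))) v]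
    exact tsum_congr fun u' => by simp only [sub_add_cancel]
  -- right side: finite sums out
  have hR : ∀ κ' : Fin (d + 1), ∑' u', coProjW (toSite r) N A κ' u' * g κ' u' =
      ∑ v ∈ cube (d + 1) N, ∑ κ : Fin (d + 1), ∑' u', A κ (u' - v) * ((pm (toSite r) N κ' u' κ (u' - v) : ℝ) * g κ' u') := by
    intro κ'
    have e1 : (fun u' => coProjW (toSite r) N A κ' u' * g κ' u') = fun u' => ∑ v ∈ cube (d + 1) N, ∑ κ : Fin (d + 1),
        A κ (u' - v) * ((pm (toSite r) N κ' u' κ (u' - v) : ℝ) * g κ' u') := by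
      funext u'
      rw [coProjW_apply, Finset.sum_mul]
      exact Finset.sum_congr rfl fun v _ => by
        rw [Finset.sum_mul]
        exact Finset.sum_congr rfl fun κ _ => by ring
    rw [e1, Summable.tsum_finsetSum (fun v _ => summable_sum fun κ _ => hs2 κ κ' v)]
    exact Finset.sum_congr rfl fun v _ => by rw [Summable.tsum_finsetSum (fun κ _ => hs2 κ κ' v)]
  simp_rw [hL, hR]
  -- both sides are now the same finite triple sum, in different orders
  set T : Fin (d + 1) → (Fin (d + 1) → ℤ) → Fin (d + 1) → ℝ := fun κ v κ' =>
    ∑' u', A κ (u' - v) * ((pm (toSite r) N κ' u' κ (u' - v) : ℝ) * g κ' u') with hT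
  show ∑ κ : Fin (d + 1), ∑ v ∈ cube (d + 1) N, ∑ κ' : Fin (d + 1), T κ v κ' =
    ∑ κ' : Fin (d + 1), ∑ v ∈ cube (d + 1) N, ∑ κ : Fin (d + 1), T κ v κ'
  calc ∑ κ : Fin (d + 1), ∑ v ∈ cube (d + 1) N, ∑ κ' : Fin (d + 1), T κ v κ'
      = ∑ v ∈ cube (d + 1) N, ∑ κ : Fin (d + 1), ∑ κ' : Fin (d + 1), T κ v κ' := Finset.sum_comm
    _ = ∑ v ∈ cube (d + 1) N, ∑ κ' : Fin (d + 1), ∑ κ : Fin (d + 1), T κ v κ' :=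
        Finset.sum_congr rfl fun v _ => Finset.sum_comm
    _ = ∑ κ' : Fin (d + 1), ∑ v ∈ cube (d + 1) N, ∑ κ : Fin (d + 1), T κ v κ' := Finset.sum_comm

/-- [folklore] **THE BOND SLOT THROUGH `K`**: the chain-rule vertex of the `Πᵀ_ρ`-dressed bond family is the superposition of
the UNDRESSED stencils with the `coProjW`-image of the `ℋ`-column as weights (decaying `K`, local `S`, in-block root). -/
theorem vertexOfK_coProjAtK {N : ℕ} (hN : 1 ≤ N) {r : Fin (d + 1) → ℕ} (hr : r ∈ box (d + 1) N)
    {K : MKer (d + 1) (Fib d)} {C δ : ℝ} (hK : Decays K C δ) (hδK : 0 < δ)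
    {S : Fin (d + 1) → (Fin (d + 1) → ℤ) → MKer (d + 1) (Fib d)} {Cs δs : ℝ} (hS : LocStencil S Cs δs) (hδs : 0 ≤ δs)
    (μ : Fin (d + 1)) (y x z : Fin (d + 1) → ℤ) (a b : Fib d) :
    vertexOfK K N (coProjAtK (toSite r) N S) μ y x z a b =
      ∑ κ' : Fin (d + 1), wsum (coProjW (toSite r) N (colH K N μ y) κ') (S κ') x z a b := by
  have hA : ∀ κ : Fin (d + 1), Summable (colH K N μ y κ) :=
    fun κ => AxialDressing.summable_col_of_decays hK hδK ((N : ℤ) • y) (Sum.inl κ) (Sum.inr μ)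
  have hg : ∀ (κ : Fin (d + 1)) (u : Fin (d + 1) → ℤ), |(fun κ u => S κ u x z a b) κ u| ≤ Cs := by
    intro κ u
    have h := hS κ u x z a b
    have hCs : 0 ≤ Cs := (hS κ u).nonneg (Sum.inl 0)
    have he : Real.exp (-δs * (l1 (x - u) + l1 (z - u))) ≤ 1 := by
      rw [Real.exp_le_one_iff]
      have := l1_nonneg (x - u)
      have := l1_nonneg (z - u)
      nlinarith
    calc |S κ u x z a b| ≤ Cs * Real.exp (-δs * (l1 (x - u) + l1 (z - u))) := h
      _ ≤ Cs * 1 := mul_le_mul_of_nonneg_left he hCs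
      _ = Cs := mul_one _
  have e1 : vertexOfK K N (coProjAtK (toSite r) N S) μ y x z a b =
      ∑ κ' : Fin (d + 1), ∑' u, colH K N μ y κ' u * coProjAt (toSite r) N (fun κ u => S κ u x z a b) κ' u := rfl
  rw [e1, sum_tsum_mul_coProjAt hN hr hA hg]
  rfl

/-- [folklore] **THE VERTEX TRANSFER**: for a decaying `K`, a jet datum `J` and an in-block root,
`vertexOfK K N (dressAt hr J).S μ y = dressKAt ρ N (vertexOfK (coDressKAt ρ N K) N J.S μ y)` — the chain-rule vertex through `K`
of the rooted-dressed stencils is the rooted dressing of the vertex through the CO-DRESSED kernel of the undressed stencils. -/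
theorem vertexOfK_dressAt_S {N : ℕ} [NeZero N] {r : Fin (d + 1) → ℕ} (hr : r ∈ box (d + 1) N)
    {K : MKer (d + 1) (Fib d)} {C δ : ℝ} (hK : Decays K C δ) (hδ : 0 < δ) (J : JetData d N) (μ : Fin (d + 1))
    (y : Fin (d + 1) → ℤ) :
    vertexOfK K N (dressAt hr J).S μ y = dressKAt (toSite r) N (vertexOfK (coDressKAt (toSite r) N K) N J.S μ y) := by
  have hN : 1 ≤ N := one_le_of_neZero N
  have e1 : vertexOfK K N (dressAt hr J).S μ y =
      dressKAt (toSite r) N (vertexOfK K N (coProjAtK (toSite r) N J.S) μ y) :=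
    vertexOfK_dressKAt (toSite r) N hK hδ.le (locStencil_coProjAtK hN hr J.loc J.δ_pos.le) J.δ_pos μ y
  rw [e1]
  congr 1
  funext x z a b
  rw [vertexOfK_coProjAtK hN hr hK hδ J.loc J.δ_pos.le, ← colH_coDressKAt_eq]
  rfl

end Adjunction

/-! ## §7 The dressed-kernel identity -/

section Hessian

/-- [folklore] **THE ROOTED DRESSING LEMMA OVER AN ARBITRARY DECAYING KERNEL `K`.**  For every decaying `K`, every jet datum `J`
and every in-block root `r`:
`hessKer K (vertexOfK K N (dressAt hr J).S) (dressAt hr J).W = hessKer G (vertexOfK G N J.S) J.W`, `G := coDressKAt (toSite r) N K`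
(`= Π_ρ K Πᵀ_ρ`).  Tadpole: `tr(K·ΠᵀWΠ) = tr(ΠKΠᵀ·W)`; bubble: `tr(K·ΠᵀV₁Π·K·ΠᵀV₂Π) = tr(G V₁ G V₂)` — tame trace cyclicity and
associativity (an5's `tr_comp_comm_loc`, `comp_assoc_tame`), every series absolutely convergent. -/
theorem hessKer_dressAt {N : ℕ} [NeZero N] {r : Fin (d + 1) → ℕ} (hr : r ∈ box (d + 1) N) {K : MKer (d + 1) (Fib d)}
    (hK : ∃ δ C : ℝ, 0 < δ ∧ 0 ≤ C ∧ Decays K C δ) (J : JetData d N) :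
    hessKer K (vertexOfK K N (dressAt hr J).S) (dressAt hr J).W =
      hessKer (coDressKAt (toSite r) N K) (vertexOfK (coDressKAt (toSite r) N K) N J.S) J.W := by
  have hN : 1 ≤ N := one_le_of_neZero N
  obtain ⟨δ, C, hδ, hC, hKd⟩ := hK
  -- the cast
  set P : MKer (d + 1) (Fib d) := piK (toSite r) N with hPdef
  set G : MKer (d + 1) (Fib d) := coDressKAt (toSite r) N K with hGdef
  have sP : Spr P := spr_piK hN hr
  have sPt : Spr (trK P) := spr_trK_piK hN hr
  have sK : Spr K := ⟨C, δ, hδ, hKd⟩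
  have sG : Spr G := spr_coDressKAt hN hr sK
  have sKP : Spr (comp K P) := spr_comp sK sP
  have sPtK : Spr (comp (trK P) K) := spr_comp sPt sK
  have hGd : ∃ δ C : ℝ, 0 < δ ∧ 0 ≤ C ∧ Decays G C δ := decays_coDressKAt hN hr ⟨δ, C, hδ, hC, hKd⟩
  obtain ⟨Cv, δv, hδv, hV⟩ := vertexFamily_vertexOfK' (N := N) hGd J.loc J.δ_pos
  have lV : ∀ μ y, Loc (vertexOfK G N J.S μ y) := fun μ y => ⟨_, _, Cv, δv, hδv, hV μ y⟩
  have lW : ∀ μ y ν y', Loc (J.W μ y ν y') := fun μ y ν y' => ⟨_, _, J.Cw, J.δ, J.δ_pos, J.loc₂ μ y ν y'⟩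
  -- G = Pᵀ (K P) (re-association of its definition)
  have hG' : comp (trK P) (comp K P) = G := by
    rw [hGdef, coDressKAt_eq, comp_assoc_tame sPt.tame sK.tame sP.tame]
  -- TADPOLE HALF
  have htad : ∀ W : MKer (d + 1) (Fib d), Loc W →
      tadpole K (dressKAt (toSite r) N W) = tadpole G W := by
    intro W lW
    have lPW : Loc (comp P W) := sP.comp_loc lW
    have lPWPt : Loc (comp (comp P W) (trK P)) := lPW.comp_spr sPt
    unfold ExpKernelCalculus.tadpole
    rw [dressKAt_eq_comp]
    calc tr (comp K (comp (comp P W) (trK P)))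
        = tr (comp (comp (comp P W) (trK P)) K) := (tr_comp_comm_loc lPWPt sK.tame).symm
      _ = tr (comp (comp P W) (comp (trK P) K)) := by rw [← comp_assoc_tame lPW.tame sPt.tame sK.tame]
      _ = tr (comp (comp (trK P) K) (comp P W)) := tr_comp_comm_loc lPW sPtK.tame
      _ = tr (comp (comp (comp (trK P) K) P) W) := by rw [comp_assoc_tame sPtK.tame sP.tame lW.tame]
      _ = tr (comp G W) := by rw [hGdef, coDressKAt_eq]
  -- BUBBLE HALF
  have hbub : ∀ V₁ V₂ : MKer (d + 1) (Fib d), Loc V₁ → Loc V₂ →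
      bubble K (dressKAt (toSite r) N V₁) (dressKAt (toSite r) N V₂) = bubble G V₁ V₂ := by
    intro V₁ V₂ l₁ l₂
    -- step 1: `K (P V Pᵀ) = ((K P) V) Pᵀ`
    have e1 : ∀ V : MKer (d + 1) (Fib d), Loc V → comp K (comp (comp P V) (trK P)) = comp (comp (comp K P) V) (trK P) := by
      intro V lV'
      rw [comp_assoc_tame sK.tame (sP.comp_loc lV').tame sPt.tame, comp_assoc_tame sK.tame sP.tame lV'.tame]
    have lA₁ : Loc (comp (comp K P) V₁) := sKP.comp_loc l₁
    have lA₂ : Loc (comp (comp K P) V₂) := sKP.comp_loc l₂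
    have lA₂Pt : Loc (comp (comp (comp K P) V₂) (trK P)) := lA₂.comp_spr sPt
    have lPtA₂ : Loc (comp (trK P) (comp (comp K P) V₂)) := sPt.comp_loc lA₂
    have lA₁PtA₂ : Loc (comp (comp (comp K P) V₁) (comp (trK P) (comp (comp K P) V₂))) := lA₁.comp lPtA₂
    -- step 3: `Pᵀ ((K P) V) = G V`
    have e3 : ∀ V : MKer (d + 1) (Fib d), Loc V → comp (trK P) (comp (comp K P) V) = comp G V := by
      intro V lV'
      rw [comp_assoc_tame sPt.tame sKP.tame lV'.tame, hG']
    unfold ExpKernelCalculus.bubble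
    rw [dressKAt_eq_comp, dressKAt_eq_comp, e1 V₁ l₁, e1 V₂ l₂]
    calc tr (comp (comp (comp (comp K P) V₁) (trK P)) (comp (comp (comp K P) V₂) (trK P)))
        = tr (comp (comp (comp K P) V₁) (comp (trK P) (comp (comp (comp K P) V₂) (trK P)))) := by
          rw [← comp_assoc_tame lA₁.tame sPt.tame lA₂Pt.tame]
      _ = tr (comp (comp (comp K P) V₁) (comp (comp (trK P) (comp (comp K P) V₂)) (trK P))) := by
          rw [comp_assoc_tame sPt.tame lA₂.tame sPt.tame]
      _ = tr (comp (comp (comp (comp K P) V₁) (comp (trK P) (comp (comp K P) V₂))) (trK P)) := by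
          rw [comp_assoc_tame lA₁.tame lPtA₂.tame sPt.tame]
      _ = tr (comp (trK P) (comp (comp (comp K P) V₁) (comp (trK P) (comp (comp K P) V₂)))) :=
          tr_comp_comm_loc lA₁PtA₂ sPt.tame
      _ = tr (comp (comp (trK P) (comp (comp K P) V₁)) (comp (trK P) (comp (comp K P) V₂))) := by
          rw [comp_assoc_tame sPt.tame lA₁.tame lPtA₂.tame]
      _ = tr (comp (comp G V₁) (comp G V₂)) := by rw [e3 V₁ l₁, e3 V₂ l₂]
  -- ASSEMBLY
  funext μ ν z
  show (1 / 2) * tadpole K ((dressAt hr J).W μ 0 ν z) -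
      (1 / 2) * bubble K (vertexOfK K N (dressAt hr J).S μ 0) (vertexOfK K N (dressAt hr J).S ν z) =
    (1 / 2) * tadpole G (J.W μ 0 ν z) - (1 / 2) * bubble G (vertexOfK G N J.S μ 0) (vertexOfK G N J.S ν z)
  rw [dressAt_W, vertexOfK_dressAt_S hr hKd hδ, vertexOfK_dressAt_S hr hKd hδ, ← hGdef, htad _ (lW μ 0 ν z),
    hbub _ _ (lV μ 0) (lV ν z)]

/-- [folklore] **THE DRESSED-KERNEL IDENTITY FOR THE STEP KERNELS (every step `j`).**  The typed step-`j` kernel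
(`OneStepKernelFamily.TstepOf`) of the rooted-dressed jets is the resolvent Hessian kernel of the CO-DRESSED decimated composite
resolvent `G_j := coDressKAt ρ Lc (KInvStep Lc j)` with the chain-rule vertex through ITS `ℋ`-column and the UNDRESSED jets:
`TstepOf Lc j (dressAt hr J) = hessKer G_j (vertexOfK G_j Lc J.S) J.W` — the shape of
`ChartConjugationEnd.axisReflectionCovariant_flipK_hessKer_conj` with `K := G_j` (X-an2-41 §4 (ii-0)). -/
theorem TstepOf_dressAt {Lc : ℕ} [NeZero Lc] {r : Fin (d + 1) → ℕ} (hr : r ∈ box (d + 1) Lc) (j : ℕ) (J : JetData d Lc) :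
    TstepOf Lc j (dressAt hr J) =
      hessKer (coDressKAt (toSite r) Lc (KInvStep (d := d) Lc j))
        (vertexOfK (coDressKAt (toSite r) Lc (KInvStep (d := d) Lc j)) Lc J.S) J.W := by
  unfold TstepOf
  exact hessKer_dressAt hr (decays_KInvStep (d := d) (Lc := Lc) j) J

/-- [folklore] **THE WALL FAMILY'S KERNELS IN CO-DRESSED FORM (dimension four, every `j`).**  For ANY step jet data
`Js : ℕ → JetData 3 Lc` and any in-block root: `TbalOf Lc (fun j ↦ dressAt hr (Js j)) j = hessKer G_j (vertexOfK G_j Lc (Js j).S) (Js j).W`.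
(The ρ-threaded spine `SpineRooted.JsBalAtOf … = dressAt hr ∘ JsBal0AtOf …` is of this form.) -/
theorem TbalOf_dressAt {Lc : ℕ} [NeZero Lc] {r : Fin 4 → ℕ} (hr : r ∈ box 4 Lc) (Js : ℕ → JetData 3 Lc) (j : ℕ) :
    TbalOf Lc (fun j => dressAt hr (Js j)) j =
      hessKer (coDressKAt (toSite r) Lc (KInvStep (d := 3) Lc j))
        (vertexOfK (coDressKAt (toSite r) Lc (KInvStep (d := 3) Lc j)) Lc (Js j).S) (Js j).W :=
  TstepOf_dressAt hr j (Js j)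

/-- [folklore] The kernel-side hypotheses `hKd` / `hKs` of the `ChartConjugationEnd` ENDs hold for `G_j`: it decays … -/
theorem decays_coDressKAt_KInvStep {Lc : ℕ} [NeZero Lc] {r : Fin (d + 1) → ℕ} (hr : r ∈ box (d + 1) Lc) (j : ℕ) :
    ∃ δ C : ℝ, 0 < δ ∧ 0 ≤ C ∧ Decays (coDressKAt (toSite r) Lc (KInvStep (d := d) Lc j)) C δ :=
  decays_coDressKAt (one_le_of_neZero Lc) hr (decays_KInvStep (d := d) (Lc := Lc) j)

/-- [folklore] … and is block-translation invariant under the `Lc`-translations of the step-`j` lattice. -/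
theorem shiftK_coDressKAt_KInvStep {Lc : ℕ} [NeZero Lc] (ρ : Fin (d + 1) → ℤ) (j : ℕ) (t : Fin (d + 1) → ℤ) :
    shiftK (-((Lc : ℤ) • t)) (coDressKAt ρ Lc (KInvStep (d := d) Lc j)) = coDressKAt ρ Lc (KInvStep (d := d) Lc j) :=
  shiftK_coDressKAt ρ (one_le_of_neZero Lc) (shiftK_KInvStep (d := d) (Lc := Lc) j) t

end Hessian

end

end Summit.QuantumFields.BalabanUV.Beta.AxialDressingRooted
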